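import Mathlib
import Summits.NavierStokesRegularity.NavierStokesRegularity.Theorems.ExtremiserTransienceNearExtremalTransienceExtremiserLiouvilleConstantSpeedTruncationEnvelopes
import HarnessLib.Audit

/-!
# LINE g7-3 «l2_budget» — GLUE LEMMAS (sorry-free companions of `Lines/l2_budget.lean`)

Two elementary joints of the chain `E ⟹ T ⟹ F ⟹ K1b`, landed here so that provers of T and F start from the analysis proper:

* `scale_iteration` — the ITERATION STEP of stub T: if a non-negative bounded quantity `m` (think `m(s) = μ{‖y‖ > s}`) satisfies
  `m(λ s) ≤ C₁/s + η(s)·m(s)` for `s ≥ s₀` with `η ≤ 1/(2λ)` there (`λ > 1`), then `s·m(s)` is bounded on `[1, ∞)`.  (No monotonicity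
  of `m` is needed.)
* `integrable_sqrt_norm_of_tail` — the HALF-MOMENT used by stub F: a finite measure `μ` on `ℝ³` with `s·μ{‖y‖ > s} ≤ C` (`s ≥ 1`) has
  `∫ ‖y‖^{1/2} dμ < ∞`.
* `rescale_boundedPotential` — the BOUNDED-POTENTIAL CLASS of lemma E is scale-stable: `x ↦ R·A(R⁻¹x)` (`R ≥ 1`) is again bounded with
  graded decay, constant `C·R`, and `curl(R·A(R⁻¹·)) = (curl A)(R⁻¹·)` — so E applies to every rescaled test `K_s = K(·/s)` of stub T
  (the tree's `rescale_decay`, adapted from the decay class to the bounded class).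

No summit, crux or stub is proved by this file; it is support for `Lines/l2_budget.lean` (stub T = `Sig.StubT`, stub F = `Sig.StubF`).
-/

open Set Filter Topology MeasureTheory

namespace Summit.NavierStokesRegularity.NavierStokesRegularity.Cruxes.NearExtremalTransience.L2Budget.Glue

set_option linter.style.longLine false
set_option linter.dupNamespace false

/-- **Iteration step of the tail law.**  `m ≥ 0`, `m ≤ m₀` on `[1,∞)`, `m(λ s) ≤ C₁/s + η(s) m(s)` and `0 ≤ η(s) ≤ 1/(2λ)` for `s ≥ s₀ ≥ 1`,
`λ > 1` ⇒ `s·m(s) ≤ max(λ s₀ m₀, 2λ|C₁|)` for all `s ≥ 1` (the lower bound `0 ≤ η` is not even needed, since `m ≥ 0`). -/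
theorem scale_iteration {m η : ℝ → ℝ} {m₀ C₁ lam s₀ : ℝ} (hlam : 1 < lam) (hs₀ : 1 ≤ s₀)
    (hm0 : ∀ s, 1 ≤ s → 0 ≤ m s) (hmb : ∀ s, 1 ≤ s → m s ≤ m₀)
    (hrec : ∀ s, s₀ ≤ s → m (lam * s) ≤ C₁ / s + η s * m s)
    (hη : ∀ s, s₀ ≤ s → η s ≤ 1 / (2 * lam)) :
    ∃ C : ℝ, ∀ s, 1 ≤ s → s * m s ≤ C := by
  have hlam0 : 0 < lam := lt_trans one_pos hlam
  have hm₀ : 0 ≤ m₀ := (hm0 1 le_rfl).trans (hmb 1 le_rfl)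
  set B : ℝ := max (lam * s₀ * m₀) (2 * lam * |C₁|) with hB
  have base : ∀ s, 1 ≤ s → s ≤ s₀ * lam → s * m s ≤ B := by
    intro s hs hsle
    calc s * m s ≤ (s₀ * lam) * m₀ := mul_le_mul hsle (hmb s hs) (hm0 s hs) (by positivity)
      _ = lam * s₀ * m₀ := by ring
      _ ≤ B := le_max_left _ _
  have key : ∀ n : ℕ, ∀ s, 1 ≤ s → s ≤ s₀ * lam ^ (n + 1) → s * m s ≤ B := by
    intro n
    induction n with
    | zero =>
        intro s hs hsle
        exact base s hs (by simpa using hsle)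
    | succ n ih =>
        intro s hs hsle
        by_cases hb : s ≤ s₀ * lam
        · exact base s hs hb
        · push Not at hb
          set s' : ℝ := s / lam with hs'
          have hss' : s = lam * s' := by rw [hs']; field_simp
          have hs'₀ : s₀ ≤ s' := by
            rw [hs', le_div_iff₀ hlam0]; exact hb.le
          have hs'1 : 1 ≤ s' := hs₀.trans hs'₀
          have hs'pos : 0 < s' := lt_of_lt_of_le one_pos hs'1
          have hs'le : s' ≤ s₀ * lam ^ (n + 1) := by
            rw [hs', div_le_iff₀ hlam0]
            calc s ≤ s₀ * lam ^ (n + 1 + 1) := hsle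
              _ = s₀ * lam ^ (n + 1) * lam := by ring
          have hih : s' * m s' ≤ B := ih s' hs'1 hs'le
          have hu0 : 0 ≤ s' * m s' := mul_nonneg hs'pos.le (hm0 s' hs'1)
          have hBC : 2 * lam * |C₁| ≤ B := le_max_right _ _
          calc s * m s = lam * s' * m (lam * s') := by rw [hss']
            _ ≤ lam * s' * (C₁ / s' + η s' * m s') :=
                mul_le_mul_of_nonneg_left (hrec s' hs'₀) (by positivity)
            _ = lam * C₁ + lam * η s' * (s' * m s') := by field_simp
            _ ≤ lam * |C₁| + lam * (1 / (2 * lam)) * B := by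
                apply add_le_add
                · exact mul_le_mul_of_nonneg_left (le_abs_self _) hlam0.le
                · exact mul_le_mul (mul_le_mul_of_nonneg_left (hη s' hs'₀) hlam0.le) hih hu0
                    (mul_nonneg hlam0.le (by positivity))
            _ = lam * |C₁| + B / 2 := by field_simp
            _ ≤ B := by linarith
  refine ⟨B, fun s hs => ?_⟩
  obtain ⟨n, hn⟩ := pow_unbounded_of_one_lt (s / s₀) hlam
  have hs₀pos : 0 < s₀ := lt_of_lt_of_le one_pos hs₀
  apply key n s hs
  have h1 : s < s₀ * lam ^ n := by
    rw [div_lt_iff₀ hs₀pos] at hn; linarith [hn]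
  have h2 : s₀ * lam ^ n ≤ s₀ * lam ^ (n + 1) := by
    apply mul_le_mul_of_nonneg_left _ hs₀pos.le
    exact pow_le_pow_right₀ hlam.le (Nat.le_succ n)
  linarith

/-- `ℝ³` as in the theses files. -/
abbrev E3 := EuclideanSpace ℝ (Fin 3)

/-- **Half-moment from the tail bound.**  A finite measure on `ℝ³` with `s·μ{‖y‖ > s} ≤ C` for `s ≥ 1` integrates `‖y‖^{1/2}`:
layer-cake `∫‖y‖^{1/2}dμ = ½∫₀^∞ t^{-1/2} μ{‖y‖ > t} dt ≤ ½(μ(ℝ³)∫₀¹ t^{-1/2}dt + C∫₁^∞ t^{-3/2}dt) < ∞`.  This is the only property of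
the multiplier's tail that stub F (the low-frequency budget) consumes. -/
theorem integrable_sqrt_norm_of_tail (μ : Measure E3) [IsFiniteMeasure μ] {C : ℝ}
    (h : ∀ s : ℝ, 1 ≤ s → s * μ.real {x : E3 | s < ‖x‖} ≤ C) :
    Integrable (fun x : E3 => Real.sqrt ‖x‖) μ := by
  have hC : 0 ≤ C := by
    have h1 := h 1 le_rfl
    rw [one_mul] at h1
    exact measureReal_nonneg.trans h1
  refine ⟨(continuous_norm.sqrt).aestronglyMeasurable, ?_⟩
  show ∫⁻ x, ‖Real.sqrt ‖x‖‖ₑ ∂μ < ⊤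
  have hrw : ∀ x : E3, ‖Real.sqrt ‖x‖‖ₑ = ENNReal.ofReal (‖x‖ ^ (1 / 2 : ℝ)) := by
    intro x
    rw [Real.enorm_eq_ofReal (Real.sqrt_nonneg _), Real.sqrt_eq_rpow]
  simp_rw [hrw]
  rw [lintegral_rpow_eq_lintegral_meas_lt_mul μ (Eventually.of_forall (fun x => norm_nonneg x))
    continuous_norm.aemeasurable (by norm_num : (0 : ℝ) < 1 / 2)]
  refine ENNReal.mul_lt_top ENNReal.ofReal_lt_top ?_
  have hsplit : Ioi (0 : ℝ) = Ioc 0 1 ∪ Ioi 1 := (Ioc_union_Ioi_eq_Ioi zero_le_one).symm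
  rw [hsplit]
  refine lt_of_le_of_lt (lintegral_union_le _ _ _) ?_
  refine ENNReal.add_lt_top.mpr ⟨?_, ?_⟩
  · -- small `t`: bound the measure by the total mass, `t^{-1/2}` is integrable on `(0,1]`
    calc ∫⁻ t in Ioc (0 : ℝ) 1, μ {a : E3 | t < ‖a‖} * ENNReal.ofReal (t ^ (1 / 2 - 1 : ℝ))
        ≤ ∫⁻ t in Ioc (0 : ℝ) 1, μ univ * ENNReal.ofReal (t ^ (1 / 2 - 1 : ℝ)) := by
          apply setLIntegral_mono' measurableSet_Ioc
          intro t _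
          gcongr
          exact subset_univ _
      _ = μ univ * ∫⁻ t in Ioc (0 : ℝ) 1, ENNReal.ofReal (t ^ (1 / 2 - 1 : ℝ)) := by
          rw [lintegral_const_mul' _ _ (measure_ne_top μ univ)]
      _ < ⊤ := by
          refine ENNReal.mul_lt_top (measure_lt_top μ univ) ?_
          have hint : IntegrableOn (fun t : ℝ => t ^ (1 / 2 - 1 : ℝ)) (Ioc 0 1) volume :=
            (intervalIntegral.intervalIntegrable_rpow' (a := 0) (b := 1)
              (by norm_num : (-1 : ℝ) < 1 / 2 - 1)).1
          have hnn : 0 ≤ᵐ[volume.restrict (Ioc (0 : ℝ) 1)] fun t : ℝ => t ^ (1 / 2 - 1 : ℝ) := by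
            filter_upwards [ae_restrict_mem measurableSet_Ioc] with t ht
            exact Real.rpow_nonneg ht.1.le _
          rw [← ofReal_integral_eq_lintegral_ofReal hint hnn]
          exact ENNReal.ofReal_lt_top
  · -- large `t`: the tail bound gives `μ{‖y‖ > t} ≤ C/t`, and `t^{-3/2}` is integrable on `(1,∞)`
    calc ∫⁻ t in Ioi (1 : ℝ), μ {a : E3 | t < ‖a‖} * ENNReal.ofReal (t ^ (1 / 2 - 1 : ℝ))
        ≤ ∫⁻ t in Ioi (1 : ℝ), ENNReal.ofReal (C * t ^ (-(3 / 2) : ℝ)) := by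
          apply setLIntegral_mono' measurableSet_Ioi
          intro t ht
          have ht1 : 1 < t := ht
          have htpos : 0 < t := by linarith
          have hμ : μ {a : E3 | t < ‖a‖} ≤ ENNReal.ofReal (C / t) := by
            rw [← ofReal_measureReal (measure_ne_top _ _)]
            apply ENNReal.ofReal_le_ofReal
            rw [le_div_iff₀ htpos]
            have := h t ht1.le
            linarith [this]
          calc μ {a : E3 | t < ‖a‖} * ENNReal.ofReal (t ^ (1 / 2 - 1 : ℝ))
              ≤ ENNReal.ofReal (C / t) * ENNReal.ofReal (t ^ (1 / 2 - 1 : ℝ)) := by gcongr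
            _ = ENNReal.ofReal (C / t * t ^ (1 / 2 - 1 : ℝ)) := by
                rw [ENNReal.ofReal_mul (div_nonneg hC htpos.le)]
            _ = ENNReal.ofReal (C * t ^ (-(3 / 2) : ℝ)) := by
                congr 1
                rw [div_eq_mul_inv, mul_assoc, ← Real.rpow_neg_one, ← Real.rpow_add htpos]
                norm_num
      _ < ⊤ := by
          have hint : IntegrableOn (fun t : ℝ => C * t ^ (-(3 / 2) : ℝ)) (Ioi 1) volume :=
            (integrableOn_Ioi_rpow_of_lt (by norm_num : (-(3 / 2) : ℝ) < -1) zero_lt_one).const_mul C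
          have hnn : 0 ≤ᵐ[volume.restrict (Ioi (1 : ℝ))] fun t : ℝ => C * t ^ (-(3 / 2) : ℝ) := by
            filter_upwards [ae_restrict_mem measurableSet_Ioi] with t ht
            exact mul_nonneg hC (Real.rpow_nonneg (zero_le_one.trans (le_of_lt ht)) _)
          rw [← ofReal_integral_eq_lintegral_ofReal hint hnn]
          exact ENNReal.ofReal_lt_top

section Rescale

open scoped ENNReal NNReal InnerProductSpace RealInnerProductSpace ContDiff
open Metric Function Literature.Analysis.FluidPDE Literature.Analysis
open Summit.NavierStokesRegularity.NavierStokesRegularity.Theorems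
open Summit.NavierStokesRegularity.NavierStokesRegularity.Theorems.ExtremiserLiouville

variable {A : E3 → E3}

/-- **The bounded-potential class is scale-stable.**  For `A ∈ C^∞` with `‖A‖ ≤ C` and `‖DᵏA(x)‖ ≤ C(1+‖x‖)^{-k}` (`k = 1,2,3`) and `R ≥ 1`,
the rescaled potential `x ↦ R·A(R⁻¹x)` satisfies the same bounds with constant `C·R`, and its curl is `(curl A)(R⁻¹·)`.  (So lemma E,
`L2Budget.boundedPotentialIdentity_holds`, applies to the whole family `K_s = (curl A)(·/s)`, `s ≥ 1`, of stub T.) [folklore] -/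
theorem rescale_boundedPotential (hA : ContDiff ℝ ∞ A) {C : ℝ} (hA0 : ∀ x, ‖A x‖ ≤ C)
    (hAk : ∀ k : ℕ, 1 ≤ k → k ≤ 3 → ∀ x, ‖iteratedFDeriv ℝ k A x‖ ≤ C * ((1 + ‖x‖) ^ k)⁻¹) {R : ℝ} (hR : 1 ≤ R) :
    ContDiff ℝ ∞ (fun x => R • A (R⁻¹ • x)) ∧ (∀ x, ‖R • A (R⁻¹ • x)‖ ≤ C * R) ∧
      (∀ k : ℕ, 1 ≤ k → k ≤ 3 → ∀ x, ‖iteratedFDeriv ℝ k (fun x => R • A (R⁻¹ • x)) x‖ ≤ C * R * ((1 + ‖x‖) ^ k)⁻¹) ∧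
      curl (fun x => R • A (R⁻¹ • x)) = fun x => curl A (R⁻¹ • x) := by
  have hR0 : 0 < R := lt_of_lt_of_le one_pos hR
  have hRinv : 0 < R⁻¹ := inv_pos.2 hR0
  have hC0 : 0 ≤ C := (norm_nonneg _).trans (hA0 0)
  set L : E3 →L[ℝ] E3 := R⁻¹ • ContinuousLinearMap.id ℝ E3 with hL
  have hLn : ‖L‖ ≤ R⁻¹ := by
    rw [hL, norm_smul, Real.norm_eq_abs, abs_of_pos hRinv]
    exact mul_le_of_le_one_right hRinv.le ContinuousLinearMap.norm_id_le
  have hcomp : (fun x => A (R⁻¹ • x)) = A ∘ L := by funext y; simp [hL]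
  have hAL : ContDiff ℝ ∞ (fun x => A (R⁻¹ • x)) := by rw [hcomp]; exact hA.comp L.contDiff
  have hsm : ContDiff ℝ ∞ (fun x => R • A (R⁻¹ • x)) := hAL.const_smul R
  -- the weight: `(1 + ‖R⁻¹x‖)^{-m} R^{-m} ≤ (1 + ‖x‖)^{-m}`
  have hw : ∀ x : E3, ∀ m : ℕ, ((1 + ‖R⁻¹ • x‖) ^ m)⁻¹ * (R⁻¹) ^ m ≤ ((1 + ‖x‖) ^ m)⁻¹ := by
    intro x m
    have hx : 0 < 1 + ‖x‖ := by positivity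
    have h1 : 1 + ‖x‖ ≤ (1 + ‖R⁻¹ • x‖) * R := by
      rw [norm_smul, Real.norm_eq_abs, abs_of_pos hRinv, add_mul, one_mul,
        show R⁻¹ * ‖x‖ * R = ‖x‖ by field_simp]
      linarith [norm_nonneg x]
    have h2 : (1 + ‖x‖) ^ m ≤ ((1 + ‖R⁻¹ • x‖) * R) ^ m := pow_le_pow_left₀ hx.le h1 m
    have h3 : ((1 + ‖R⁻¹ • x‖) ^ m)⁻¹ * (R⁻¹) ^ m = (((1 + ‖R⁻¹ • x‖) * R) ^ m)⁻¹ := by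
      rw [mul_pow, mul_inv, inv_pow]
    rw [h3]
    exact inv_anti₀ (pow_pos hx m) h2
  refine ⟨hsm, fun x => ?_, fun k hk1 hk3 x => ?_, ?_⟩
  · rw [norm_smul, Real.norm_eq_abs, abs_of_pos hR0]
    calc R * ‖A (R⁻¹ • x)‖ ≤ R * C := mul_le_mul_of_nonneg_left (hA0 _) hR0.le
      _ = C * R := by ring
  · have e1 : iteratedFDeriv ℝ k (fun x => R • A (R⁻¹ • x)) x = R • iteratedFDeriv ℝ k (fun x => A (R⁻¹ • x)) x :=
      iteratedFDeriv_const_smul_apply' (hAL.contDiffAt.of_le (by exact_mod_cast le_top))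
    rw [e1, norm_smul, Real.norm_eq_abs, abs_of_pos hR0, hcomp,
      ContinuousLinearMap.iteratedFDeriv_comp_right L hA x (by exact_mod_cast le_top)]
    have h2 := ContinuousMultilinearMap.norm_compContinuousLinearMap_le (iteratedFDeriv ℝ k A (L x)) fun _ => L
    rw [Finset.prod_const, Finset.card_univ, Fintype.card_fin] at h2
    have h3 : ‖L‖ ^ k ≤ (R⁻¹) ^ k := pow_le_pow_left₀ (norm_nonneg _) hLn k
    have h4 : L x = R⁻¹ • x := by simp [hL]
    have h5 := hAk k hk1 hk3 (L x)
    rw [h4] at h5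
    have h6 := hw x k
    calc R * ‖(iteratedFDeriv ℝ k A (L x)).compContinuousLinearMap fun _ => L‖
        ≤ R * (‖iteratedFDeriv ℝ k A (L x)‖ * ‖L‖ ^ k) := mul_le_mul_of_nonneg_left h2 hR0.le
      _ ≤ R * (‖iteratedFDeriv ℝ k A (L x)‖ * (R⁻¹) ^ k) :=
          mul_le_mul_of_nonneg_left (mul_le_mul_of_nonneg_left h3 (norm_nonneg _)) hR0.le
      _ ≤ R * (C * ((1 + ‖R⁻¹ • x‖) ^ k)⁻¹ * (R⁻¹) ^ k) := by
          rw [h4]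
          exact mul_le_mul_of_nonneg_left (mul_le_mul_of_nonneg_right h5 (by positivity)) hR0.le
      _ = C * R * (((1 + ‖R⁻¹ • x‖) ^ k)⁻¹ * (R⁻¹) ^ k) := by ring
      _ ≤ C * R * ((1 + ‖x‖) ^ k)⁻¹ := mul_le_mul_of_nonneg_left h6 (by positivity)
  · funext x
    have hd : Differentiable ℝ A := hA.differentiable (by simp)
    have hdL : DifferentiableAt ℝ (fun x => A (R⁻¹ • x)) x := (hasFDerivAt_rescale hd R x).differentiableAt
    rw [show (fun x => R • A (R⁻¹ • x)) = fun x => R • (fun y => A (R⁻¹ • y)) x from rfl, curl_const_smul hdL,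
      curl_rescale hd, smul_smul, mul_inv_cancel₀ hR0.ne', one_smul]

end Rescale

end Summit.NavierStokesRegularity.NavierStokesRegularity.Cruxes.NearExtremalTransience.L2Budget.Glue
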